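import Mathlib.Geometry.Manifold.Instances.Sphere
import Mathlib.Geometry.Manifold.SmoothEmbedding
import Mathlib.Geometry.Manifold.Diffeomorph
import Mathlib.AlgebraicTopology.FundamentalGroupoid.SimplyConnected
import Literature.Topology.FourManifolds.Knots
import Literature.Topology.FourManifolds.ConnectedSum
import HarnessLib

-- D-0014 sorry-sweep (operator, 2026-08-13): sorried theorems -> named facts `def X : Prop`; partial proofs preserved in comments
-- provenance: harness21/H21/H21/Prelude/FourManM/GluckTwist.lean @ 53e468a (interim HEAD d8f2665); M5 mechanical rewrite
/-!
# The Gluck twist of a 2-knot (trunk T-4MAN, outline C16)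

This prelude file of the H21 library (trunk `FourManM`, four-manifolds and knots; notion
`gluck_twist`, relational form of `gluing_along_boundary`) defines the **Gluck twist** `Σ_K` of a
2-knot `K : S² ↪ S⁴`: remove an open tubular neighbourhood `νK ≅ S² × D²` of `K` from `S⁴` and glue
`S² × D²` back by the diffeomorphism `τ : S² × S¹ → S² × S¹`, `τ (x, θ) = (rot_θ x, θ)`, where `rot_θ`
is the rotation of `S²` about its polar axis through the angle `θ` (H. Gluck, *The embedding of
two-spheres in the four-sphere*, Trans. AMS 104 (1962), 308–333, §§6, 8, 17). The resulting
closed smooth 4-manifold is a homotopy 4-sphere, hence homeomorphic to `S⁴` (Freedman 1982); whether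
it is always diffeomorphic to `S⁴` is open (the Gluck twist conjecture, stated in
`H21/Statements/SPC4/SurgeryGluck.lean`).

## Contents

* `Literature.TwoKnot.TubularNbhd K`: a (trivialised) open tubular neighbourhood `S² × ℝ² ↪ S⁴` of a
  2-knot `K` (the normal bundle of an embedded `S²` in `S⁴` is trivial since its Euler number, the
  self-intersection of `K` in `S⁴`, vanishes); `Literature.Topology.FourManifolds.TwoKnot.nonempty_tubularNbhd`.
* `Literature.rotateSphereTwo u`: the rotation of `S²` in the first two coordinates by the unit vector
  `u = (c, s) ∈ S¹` (angle `θ` with `u = (cos θ, sin θ)`); `Literature.unitVector w = w / ‖w‖`.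
* `Literature.gluckMap : S² × ℝ² → S² × ℝ²`, `(x, w) ↦ (rot_{w/‖w‖} x, w)`: Gluck's map `τ` extended
  radially to the punctured plane (a self-diffeomorphism of `S² × (ℝ² ∖ {0})`).
* `Literature.gluckRel ν`: the gluing relation between the knot complement `S⁴ ∖ K(S²)` and `S² × ℝ²`:
  the point `ν (gluckMap (x, w))`, `w ≠ 0`, of the complement is identified with `(x, w)`.
* `Literature.IsGluckTwist IX X K`: the manifold `X` *is a* Gluck twist of `S⁴` along `K`, i.e. an open
  gluing (`Literature.Topology.FourManifolds.IsOpenGluing`) of `S⁴ ∖ K(S²)` and `S² × ℝ²` along `gluckRel ν` for some tubular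
  neighbourhood `ν`.
* `Literature.Topology.FourManifolds.unknotTwo`: the unknotted 2-sphere `S² ⊆ S⁴` (equatorial inclusion).
* Sorried known theorems: existence (`exists_isGluckTwist`), independence of `ν` and of the isotopy
  class of `K` (`nonempty_diffeomorph_of_isGluckTwist`, Gluck 1962 §8), simple connectivity and
  `Σ_K ≃ₜ S⁴` (`simplyConnectedSpace_of_isGluckTwist`, `nonempty_homeomorph_sphere_of_isGluckTwist`;
  Gluck 1962 §17 + Freedman 1982), and `Σ_{unknot} = S⁴` (`isGluckTwist_sphere_unknotTwo`).

## Sources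

* H. Gluck, *The embedding of two-spheres in the four-sphere*, Trans. Amer. Math. Soc. 104 (1962),
  308–333.
* C. McA. Gordon, *Knots in the 4-sphere*, Comment. Math. Helv. 51 (1976), 585–596, §§2–4.
* R. Gompf, A. Stipsicz, *4-Manifolds and Kirby Calculus* (1999), §6.2 (Gluck twist), Ex. 6.2.2.
* R. Kirby, *Problems in low-dimensional topology* (1997), Problem 4.24.
* M. Freedman, *The topology of four-dimensional manifolds*, J. Diff. Geom. 17 (1982), Thm 1.6.

## Mathlib status and design choices

* Mathlib has the round spheres as smooth manifolds (`Mathlib.Geometry.Manifold.Instances.Sphere`),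
  smooth embeddings (`Manifold.IsSmoothEmbedding`), diffeomorphisms and `SimplyConnectedSpace`, but
  no tubular neighbourhoods, no rotations of `S²` as maps of the sphere, no gluing of manifolds and
  no Gluck twist (searched `Gluck`, `rotateSphere`, `unitVector`, `tubular`).
* Following outline Design 3 (relational gluings, as `Literature.Topology.FourManifolds.IsConnectedSum`), no quotient type is
  built: `IsGluckTwist IX X K` is an honest `Prop` about a given manifold `X`; existence and
  uniqueness are (sorried) theorems.
* The open piece `S⁴ ∖ K(S²)` is `K.complement : Opens (𝕊 4)` with Mathlib's open-submanifold
  structure; the piece glued in is the *open* model `S² × ℝ²` (rather than `S² × D²`), glued along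
  `S² × (ℝ² ∖ {0})`; this is the same manifold (shrink `ν` radially).
* Unlike `Knot.TubularNbhd` (Dehn surgery), `TwoKnot.TubularNbhd` carries **no orientation field**:
  the Gluck twist is independent of the choice of tubular neighbourhood and of its orientation,
  since `τ` is, up to isotopy, the unique non-trivial element of `π₀ Diff(S² × S¹)` modulo those
  extending over `S² × D²`, and it is conjugation invariant under the reflections (Gluck 1962, §8;
  Gompf–Stipsicz §6.2) (outline review #2).
* The Gluck map is written through the unit vector `w / ‖w‖ ∈ S¹` and the explicit rotation matrix
  `((c, -s), (s, c))`, **not** through `Complex.arg` (which is discontinuous) (outline review #12).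
  Its value at `w = 0` (the identity) is a documented junk value, never used: `gluckRel` requires
  `w ≠ 0`.
* Notation `𝔼 n`, `𝕊 n` is local, exactly as in the SPC4 statement files and `Knots.lean`.
-/

open scoped Manifold ContDiff Topology
open Function Set

noncomputable section

namespace Literature.Topology.FourManifolds

/-- Local notation: `𝔼 n` is the model Euclidean space `EuclideanSpace ℝ (Fin n)`. -/
local notation "𝔼 " n:arg => EuclideanSpace ℝ (Fin n)

/-- Local notation: `𝕊 n` is the unit sphere in `EuclideanSpace ℝ (Fin (n + 1))`, the standard
`n`-sphere with its Mathlib manifold structure. -/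
local notation "𝕊 " n:arg => (Metric.sphere (0 : EuclideanSpace ℝ (Fin (n + 1))) 1)

/-! ## Tubular neighbourhoods of 2-knots -/

/-- A (trivialised, open) **tubular neighbourhood** of a 2-sphere `K : 𝕊 2 → 𝕊 4` in the
4-sphere: a smooth embedding `ν : 𝕊 2 × ℝ² → 𝕊 4` restricting to `K` on the zero section,
`ν (x, 0) = K x`. Every smooth 2-knot has one, since the normal bundle of an embedded 2-sphere in
`S⁴` is trivial (its Euler number is the self-intersection number `K · K = 0` in `H₂(S⁴) = 0`).
Unlike `Knot.TubularNbhd` no orientation (framing) field is recorded: the Gluck twist is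
independent of the tubular neighbourhood and of its orientation (Gluck, *The embedding of
two-spheres in the four-sphere*, Trans. AMS 104 (1962), §8; Gompf–Stipsicz, *4-Manifolds and
Kirby Calculus*, §6.2; outline review #2). [folklore] -/
structure TwoKnot.TubularNbhd (K : 𝕊 2 → 𝕊 4) where
  /-- The embedding `𝕊 2 × ℝ² → 𝕊 4` of the (open) normal disc bundle. -/
  toFun : (𝕊 2) × 𝔼 2 → 𝕊 4
  /-- The map is a `C^∞` embedding for the product smooth structure. -/
  isSmoothEmbedding : Manifold.IsSmoothEmbedding ((𝓡 2).prod 𝓘(ℝ, 𝔼 2)) (𝓡 4) ∞ toFun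
  /-- On the zero section the map is the 2-knot `K`. -/
  apply_zero : ∀ x, toFun (x, 0) = K x

namespace TwoKnot.TubularNbhd

variable {K : 𝕊 2 → 𝕊 4} (ν : TwoKnot.TubularNbhd K)

/-- A tubular neighbourhood map is injective. [folklore] -/
protected theorem injective : Injective ν.toFun :=
  ν.isSmoothEmbedding.isEmbedding.injective

/-- A tubular neighbourhood map is continuous. [folklore] -/
protected theorem continuous : Continuous ν.toFun :=
  ν.isSmoothEmbedding.isEmbedding.continuous

/-- A tubular neighbourhood map is `C^∞`. [folklore] -/
protected theorem contMDiff : ContMDiff ((𝓡 2).prod 𝓘(ℝ, 𝔼 2)) (𝓡 4) ∞ ν.toFun :=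
  ν.isSmoothEmbedding.contMDiff

/-- Off the zero section a tubular neighbourhood misses the knot: `ν (x, w) ∉ K(𝕊 2)` for
`w ≠ 0` (injectivity of `ν` and `ν (y, 0) = K y`). Gluck (1962), §6. [cite: GluckTAMS1962] -/
theorem apply_mem_compl_range (x : 𝕊 2) {w : 𝔼 2} (hw : w ≠ 0) :
    ν.toFun (x, w) ∈ (range K)ᶜ := by
  rintro ⟨y, hy⟩
  rw [← ν.apply_zero] at hy
  exact hw (congrArg Prod.snd (ν.injective hy)).symm

/-- The image of a tubular neighbourhood contains the knot. [folklore] -/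
theorem range_subset_range : range K ⊆ range ν.toFun := by
  rintro _ ⟨y, rfl⟩
  exact ⟨(y, 0), ν.apply_zero y⟩

end TwoKnot.TubularNbhd

/-- **Existence of tubular neighbourhoods of 2-knots**: every smooth 2-knot `K : S² ↪ S⁴` has a
trivialised open tubular neighbourhood `S² × ℝ² ↪ S⁴` (tubular neighbourhood theorem, Hirsch,
*Differential Topology* (1976), Thm 4.5.2, plus triviality of the normal bundle: an oriented plane
bundle over `S²` with Euler number `K · K = 0` is trivial; Gluck (1962), §6;
Gompf–Stipsicz §6.2). [cite: GluckTAMS1962] -/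
def TwoKnot.nonempty_tubularNbhd : Prop :=
  ∀ (K : TwoKnot),
    Nonempty (TwoKnot.TubularNbhd K)

/-! ## Rotations of the 2-sphere and the Gluck map -/

/-- The **rotation of `𝕊 2` about the `x₂`-axis** by the unit vector `u = (c, s) ∈ 𝕊 1` (i.e.
through the angle `θ` if `u = (cos θ, sin θ)`):
`(x₀, x₁, x₂) ↦ (c x₀ - s x₁, s x₀ + c x₁, x₂)`. It preserves the sphere since `c² + s² = 1`.
Gluck (1962), §8 (the map `rot_θ`); Gompf–Stipsicz, *4-Manifolds and Kirby Calculus*, §6.2.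
[cite: GluckTAMS1962, §8] -/
def rotateSphereTwo (u : 𝕊 1) (x : 𝕊 2) : 𝕊 2 :=
  ⟨WithLp.toLp 2 ![(u : 𝔼 2) 0 * (x : 𝔼 3) 0 - (u : 𝔼 2) 1 * (x : 𝔼 3) 1,
      (u : 𝔼 2) 1 * (x : 𝔼 3) 0 + (u : 𝔼 2) 0 * (x : 𝔼 3) 1, (x : 𝔼 3) 2], by
    have hu := norm_eq_of_mem_sphere u
    have hx := norm_eq_of_mem_sphere x
    rw [EuclideanSpace.norm_eq, Real.sqrt_eq_one, Fin.sum_univ_two] at hu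
    rw [EuclideanSpace.norm_eq, Real.sqrt_eq_one, Fin.sum_univ_three] at hx
    rw [mem_sphere_zero_iff_norm, EuclideanSpace.norm_eq, Real.sqrt_eq_one, Fin.sum_univ_three]
    simp only [Real.norm_eq_abs, sq_abs] at hu hx ⊢
    simp only [Matrix.cons_val_zero, Matrix.cons_val_one, Matrix.cons_val]
    linear_combination ((x : 𝔼 3) 0 ^ 2 + (x : 𝔼 3) 1 ^ 2) * hu + hx⟩

/-- Coordinates of the rotation: first coordinate. [folklore] -/
@[simp]
theorem rotateSphereTwo_apply_zero (u : 𝕊 1) (x : 𝕊 2) :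
    (rotateSphereTwo u x : 𝔼 3) 0 = (u : 𝔼 2) 0 * (x : 𝔼 3) 0 - (u : 𝔼 2) 1 * (x : 𝔼 3) 1 :=
  rfl

/-- Coordinates of the rotation: second coordinate. [folklore] -/
@[simp]
theorem rotateSphereTwo_apply_one (u : 𝕊 1) (x : 𝕊 2) :
    (rotateSphereTwo u x : 𝔼 3) 1 = (u : 𝔼 2) 1 * (x : 𝔼 3) 0 + (u : 𝔼 2) 0 * (x : 𝔼 3) 1 :=
  rfl

/-- Coordinates of the rotation: the last coordinate (the axis) is fixed. [folklore] -/
@[simp]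
theorem rotateSphereTwo_apply_two (u : 𝕊 1) (x : 𝕊 2) :
    (rotateSphereTwo u x : 𝔼 3) 2 = (x : 𝔼 3) 2 :=
  rfl

/-- The inverse unit vector `(c, -s)` of `u = (c, s) ∈ 𝕊 1` (complex conjugate), used to invert
rotations. [folklore] -/
theorem conj_mem_sphere (u : 𝕊 1) : (WithLp.toLp 2 ![(u : 𝔼 2) 0, -(u : 𝔼 2) 1] : 𝔼 2) ∈ 𝕊 1 := by
  have hu := norm_eq_of_mem_sphere u
  rw [EuclideanSpace.norm_eq, Real.sqrt_eq_one, Fin.sum_univ_two] at hu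
  rw [mem_sphere_zero_iff_norm, EuclideanSpace.norm_eq, Real.sqrt_eq_one, Fin.sum_univ_two]
  simpa using hu

/-- Rotating by `u = (c, s)` and then by `(c, -s)` is the identity. [folklore] -/
theorem rotateSphereTwo_conj_rotateSphereTwo (u : 𝕊 1) (x : 𝕊 2) :
    rotateSphereTwo ⟨_, conj_mem_sphere u⟩ (rotateSphereTwo u x) = x := by
  have hu := norm_eq_of_mem_sphere u
  rw [EuclideanSpace.norm_eq, Real.sqrt_eq_one, Fin.sum_univ_two] at hu
  simp only [Real.norm_eq_abs, sq_abs] at hu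
  apply Subtype.ext
  ext i
  fin_cases i
  · simp only [Fin.zero_eta, rotateSphereTwo_apply_zero, rotateSphereTwo_apply_one,
      Matrix.cons_val_zero, Matrix.cons_val_one]
    linear_combination (x : 𝔼 3) 0 * hu
  · simp only [Fin.mk_one, rotateSphereTwo_apply_zero, rotateSphereTwo_apply_one,
      Matrix.cons_val_zero, Matrix.cons_val_one]
    linear_combination (x : 𝔼 3) 1 * hu
  · rfl

/-- Rotations of `𝕊 2` are injective (rotate back by `(c, -s)`). [folklore] -/
theorem rotateSphereTwo_injective (u : 𝕊 1) : Injective (rotateSphereTwo u) :=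
  HasLeftInverse.injective ⟨_, rotateSphereTwo_conj_rotateSphereTwo u⟩

/-- Rotations of `𝕊 2` are surjective (rotate back by `(c, -s)`). [folklore] -/
theorem rotateSphereTwo_surjective (u : 𝕊 1) : Surjective (rotateSphereTwo u) := by
  intro y
  refine ⟨rotateSphereTwo ⟨_, conj_mem_sphere u⟩ y, ?_⟩
  have hu : (⟨_, conj_mem_sphere ⟨_, conj_mem_sphere u⟩⟩ : 𝕊 1) = u := by
    apply Subtype.ext
    ext i
    fin_cases i <;> simp
  have h := rotateSphereTwo_conj_rotateSphereTwo ⟨_, conj_mem_sphere u⟩ y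
  rwa [hu] at h

/-- Rotations of `𝕊 2` are bijective. [folklore] -/
theorem rotateSphereTwo_bijective (u : 𝕊 1) : Bijective (rotateSphereTwo u) :=
  ⟨rotateSphereTwo_injective u, rotateSphereTwo_surjective u⟩

/-- The rotation by `circlePoint 0 = (1, 0)` (angle `0`) is the identity. [folklore] -/
@[simp]
theorem rotateSphereTwo_circlePoint_zero : rotateSphereTwo (circlePoint 0) = id := by
  funext x
  apply Subtype.ext
  ext i
  fin_cases i <;> simp

/-- The bilinear map `ℝ² × ℝ³ → ℝ³`, `((c, s), (x₀, x₁, x₂)) ↦ (c x₀ - s x₁, s x₀ + c x₁, x₂)`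
whose restriction to `𝕊 1 × 𝕊 2` is `rotateSphereTwo` (auxiliary, for smoothness). [folklore] -/
def rotateSphereTwoAux (q : 𝔼 2 × 𝔼 3) : 𝔼 3 :=
  WithLp.toLp 2 ![q.1 0 * q.2 0 - q.1 1 * q.2 1, q.1 1 * q.2 0 + q.1 0 * q.2 1, q.2 2]

/-- The auxiliary bilinear map is `C^∞`. [folklore] -/
theorem contDiff_rotateSphereTwoAux : ContDiff ℝ ∞ rotateSphereTwoAux := by
  unfold rotateSphereTwoAux
  apply PiLp.contDiff_toLp.comp
  rw [contDiff_pi]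
  intro i
  fin_cases i <;> simp <;> fun_prop

/-- `rotateSphereTwo` is the restriction of `rotateSphereTwoAux` to `𝕊 1 × 𝕊 2`. [folklore] -/
theorem coe_rotateSphereTwo (u : 𝕊 1) (x : 𝕊 2) :
    (rotateSphereTwo u x : 𝔼 3) = rotateSphereTwoAux ((u : 𝔼 2), (x : 𝔼 3)) := rfl

/-- The rotation `(u, x) ↦ rotateSphereTwo u x` is jointly `C^∞` on `𝕊 1 × 𝕊 2`: it is the
restriction of the smooth bilinear map `rotateSphereTwoAux` (`contMDiff_coe_sphere`,
`ContMDiff.codRestrict_sphere`). Gluck (1962), §8.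
[cite: GluckTAMS1962, §8] -/
theorem contMDiff_rotateSphereTwo :
    ContMDiff ((𝓡 1).prod (𝓡 2)) (𝓡 2) ∞ (fun p : (𝕊 1) × (𝕊 2) ↦ rotateSphereTwo p.1 p.2) := by
  haveI := Fact.mk (@finrank_euclideanSpace_fin ℝ _ (1 + 1))
  haveI := Fact.mk (@finrank_euclideanSpace_fin ℝ _ (2 + 1))
  have h1 : ContMDiff ((𝓡 1).prod (𝓡 2)) 𝓘(ℝ, 𝔼 2) ∞ (fun p : (𝕊 1) × (𝕊 2) ↦ (p.1 : 𝔼 2)) :=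
    contMDiff_coe_sphere.comp contMDiff_fst
  have h2 : ContMDiff ((𝓡 1).prod (𝓡 2)) 𝓘(ℝ, 𝔼 3) ∞ (fun p : (𝕊 1) × (𝕊 2) ↦ (p.2 : 𝔼 3)) :=
    contMDiff_coe_sphere.comp contMDiff_snd
  have h : ContMDiff ((𝓡 1).prod (𝓡 2)) 𝓘(ℝ, 𝔼 3) ∞
      (fun p : (𝕊 1) × (𝕊 2) ↦ (rotateSphereTwo p.1 p.2 : 𝔼 3)) :=
    contDiff_rotateSphereTwoAux.contMDiff.comp (h1.prodMk_space h2)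
  exact h.codRestrict_sphere fun p ↦ (rotateSphereTwo p.1 p.2).2

/-- For fixed `u` the rotation `rotateSphereTwo u` is `C^∞`. Gluck (1962), §8.
[cite: GluckTAMS1962, §8] -/
theorem contMDiff_rotateSphereTwo_right (u : 𝕊 1) :
    ContMDiff (𝓡 2) (𝓡 2) ∞ (rotateSphereTwo u) :=
  contMDiff_rotateSphereTwo.comp (contMDiff_const.prodMk contMDiff_id)

/-- The **unit vector** `w / ‖w‖ ∈ 𝕊 1` of a non-zero vector `w ∈ ℝ²` (radial projection to the
circle). Standard. [folklore] -/
def unitVector (w : 𝔼 2) (hw : w ≠ 0) : 𝕊 1 :=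
  ⟨‖w‖⁻¹ • w, by
    rw [mem_sphere_zero_iff_norm, norm_smul, norm_inv, norm_norm,
      inv_mul_cancel₀ (norm_ne_zero_iff.2 hw)]⟩

/-- The unit vector of `w` is `‖w‖⁻¹ • w`. [folklore] -/
@[simp]
theorem coe_unitVector (w : 𝔼 2) (hw : w ≠ 0) : (unitVector w hw : 𝔼 2) = ‖w‖⁻¹ • w := rfl

/-- The unit vector of a unit vector is itself. [folklore] -/
@[simp]
theorem unitVector_coe (u : 𝕊 1) (hu : (u : 𝔼 2) ≠ 0 := ne_zero_of_mem_unit_sphere u) :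
    unitVector u hu = u := by
  apply Subtype.ext
  simp [norm_eq_of_mem_sphere u]

/-- The unit vector is invariant under positive rescaling. [folklore] -/
theorem unitVector_smul {t : ℝ} (ht : 0 < t) (w : 𝔼 2) (hw : w ≠ 0)
    (htw : t • w ≠ 0 := smul_ne_zero ht.ne' hw) : unitVector (t • w) htw = unitVector w hw := by
  apply Subtype.ext
  simp only [coe_unitVector, norm_smul, Real.norm_eq_abs, abs_of_pos ht, mul_inv, smul_smul]
  congr 1
  field_simp

/-- The **Gluck map** `𝕊 2 × ℝ² → 𝕊 2 × ℝ²`, `(x, w) ↦ (rot_{w/‖w‖} x, w)`: Gluck's diffeomorphism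
`τ (x, θ) = (rot_θ x, θ)` of `S² × S¹` (Gluck, Trans. AMS 104 (1962), §8; Gompf–Stipsicz,
*4-Manifolds and Kirby Calculus*, §6.2), extended radially to `S² × (ℝ² ∖ {0})`. At `w = 0` the
value `(x, 0)` is a **junk value** (the map does not extend continuously across `w = 0`); it is
never used, since the gluing relation `gluckRel` only involves points with `w ≠ 0`. Defined via the
unit vector `w / ‖w‖`, not via `Complex.arg` (outline review #12). [folklore] -/
def gluckMap (p : (𝕊 2) × 𝔼 2) : (𝕊 2) × 𝔼 2 :=
  if h : p.2 = 0 then p else (rotateSphereTwo (unitVector p.2 h) p.1, p.2)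

/-- The Gluck map preserves the second (`ℝ²`) coordinate. [folklore] -/
@[simp]
theorem gluckMap_snd (p : (𝕊 2) × 𝔼 2) : (gluckMap p).2 = p.2 := by
  unfold gluckMap
  split_ifs <;> rfl

/-- The Gluck map off the zero section. [folklore] -/
theorem gluckMap_apply_of_ne_zero (x : 𝕊 2) {w : 𝔼 2} (hw : w ≠ 0) :
    gluckMap (x, w) = (rotateSphereTwo (unitVector w hw) x, w) := by
  simp [gluckMap, hw]

/-- The (junk) value of the Gluck map on the zero section is the identity. [folklore] -/
@[simp]
theorem gluckMap_apply_zero (x : 𝕊 2) : gluckMap (x, 0) = (x, 0) := by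
  simp [gluckMap]

/-- The Gluck map maps the complement of the zero section to itself. [folklore] -/
theorem mapsTo_gluckMap :
    MapsTo gluckMap {p : (𝕊 2) × 𝔼 2 | p.2 ≠ 0} {p : (𝕊 2) × 𝔼 2 | p.2 ≠ 0} := by
  intro p hp
  simpa using hp

/-- The Gluck map is a bijection of `𝕊 2 × (ℝ² ∖ {0})` onto itself; its inverse is
`(x, w) ↦ (rot_{w̄/‖w‖} x, w)` (rotate back by the conjugate unit vector). Gluck (1962), §8.
[cite: GluckTAMS1962, §8] -/
theorem bijOn_gluckMap :
    BijOn gluckMap {p : (𝕊 2) × 𝔼 2 | p.2 ≠ 0} {p : (𝕊 2) × 𝔼 2 | p.2 ≠ 0} := by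
  refine ⟨mapsTo_gluckMap, ?_, ?_⟩
  · rintro ⟨x, w⟩ hw ⟨x', w'⟩ hw' h
    have h2 : w = w' := by simpa using congrArg Prod.snd h
    subst h2
    simp only [mem_setOf_eq] at hw
    rw [gluckMap_apply_of_ne_zero x hw, gluckMap_apply_of_ne_zero x' hw, Prod.mk.injEq] at h
    rw [rotateSphereTwo_injective _ h.1]
  · rintro ⟨y, w⟩ hw
    simp only [mem_setOf_eq] at hw
    obtain ⟨x, hx⟩ := rotateSphereTwo_surjective (unitVector w hw) y
    exact ⟨(x, w), hw, by rw [gluckMap_apply_of_ne_zero x hw, hx]⟩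

/-- The Gluck map is `C^∞` on `𝕊 2 × (ℝ² ∖ {0})` (composition of the smooth radial projection
`w ↦ w / ‖w‖`, smooth away from `0`, with the smooth rotation map `contMDiff_rotateSphereTwo`).
Gluck (1962), §8.
[cite: GluckTAMS1962, §8] -/
def contMDiffOn_gluckMap : Prop :=
  ContMDiffOn ((𝓡 2).prod 𝓘(ℝ, 𝔼 2)) ((𝓡 2).prod 𝓘(ℝ, 𝔼 2)) ∞ gluckMap
      {p : (𝕊 2) × 𝔼 2 | p.2 ≠ 0}

/-! ## The Gluck twist -/

section GluckTwist

variable {K : TwoKnot}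

/-- The **Gluck gluing relation** for a tubular neighbourhood `ν` of the 2-knot `K`: the point `a`
of the knot complement `𝕊 4 ∖ K(𝕊 2)` is identified with the point `b = (x, w)`, `w ≠ 0`, of
`𝕊 2 × ℝ²` iff `a = ν (gluckMap (x, w)) = ν (rot_{w/‖w‖} x, w)`. Thus `𝕊 2 × ℝ²` is glued back
into `𝕊 4 ∖ K(𝕊 2) ⊇ ν (𝕊 2 × (ℝ² ∖ {0}))` by Gluck's twist `τ` on each torus `𝕊 2 × {‖w‖ = r}`
(Gluck, Trans. AMS 104 (1962), §8; Gompf–Stipsicz §6.2). [folklore] -/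
def gluckRel (ν : TwoKnot.TubularNbhd K) (a : K.complement) (b : (𝕊 2) × 𝔼 2) : Prop :=
  b.2 ≠ 0 ∧ (a : 𝕊 4) = ν.toFun (gluckMap b)

/-- For `w ≠ 0` the point `ν (gluckMap (x, w))` lies in the knot complement and is related to
`(x, w)`. [folklore] -/
theorem gluckRel_mk_gluckMap (ν : TwoKnot.TubularNbhd K) (x : 𝕊 2) {w : 𝔼 2} (hw : w ≠ 0)
    (h : ν.toFun (gluckMap (x, w)) ∈ K.complement := by
      rw [gluckMap_apply_of_ne_zero x hw]; exact ν.apply_mem_compl_range _ hw) :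
    gluckRel ν ⟨ν.toFun (gluckMap (x, w)), h⟩ (x, w) :=
  ⟨hw, rfl⟩

/-- Each point of `𝕊 2 × ℝ²` is related to at most one point of the complement. [folklore] -/
theorem gluckRel.eq_of_eq {ν : TwoKnot.TubularNbhd K} {a a' : K.complement} {b : (𝕊 2) × 𝔼 2}
    (h : gluckRel ν a b) (h' : gluckRel ν a' b) : a = a' :=
  Subtype.ext (h.2.trans h'.2.symm)

variable {EX HX : Type*} [NormedAddCommGroup EX] [NormedSpace ℝ EX] [TopologicalSpace HX]

/-- **The Gluck twist** (relational form). `IsGluckTwist IX X K` says that the manifold `X`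
(modelled on `IX`) is *a Gluck twist of `S⁴` along the 2-knot `K`*,
`X ≅ Σ_K = (S⁴ ∖ νK) ∪_τ (S² × D²)`: for some tubular neighbourhood `ν` of `K`, `X` is the open
gluing (`Literature.Topology.FourManifolds.IsOpenGluing`) of the knot complement `𝕊 4 ∖ K(𝕊 2)` and `𝕊 2 × ℝ²` along the Gluck
relation `gluckRel ν`, i.e. there are open smooth embeddings of both pieces into `X`, jointly
surjective, identifying exactly `ν (rot_{w/‖w‖} x, w)` with `(x, w)` for `w ≠ 0`
(Gluck, *The embedding of two-spheres in the four-sphere*, Trans. AMS 104 (1962), §§8, 17;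
Gompf–Stipsicz, *4-Manifolds and Kirby Calculus*, §6.2; outline Design 3). [folklore] -/
def IsGluckTwist (IX : ModelWithCorners ℝ EX HX) (X : Type*) [TopologicalSpace X]
    [ChartedSpace HX X] (K : TwoKnot) : Prop :=
  ∃ ν : TwoKnot.TubularNbhd K,
    IsOpenGluing (𝓡 4) ((𝓡 2).prod 𝓘(ℝ, 𝔼 2)) IX (A := K.complement) (B := (𝕊 2) × 𝔼 2) (P := X)
      (gluckRel ν)

variable {IX : ModelWithCorners ℝ EX HX} {X : Type*} [TopologicalSpace X] [ChartedSpace HX X]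

/-- Unfolding of `IsGluckTwist`. [folklore] -/
theorem isGluckTwist_iff : IsGluckTwist IX X K ↔ ∃ ν : TwoKnot.TubularNbhd K,
    IsOpenGluing (𝓡 4) ((𝓡 2).prod 𝓘(ℝ, 𝔼 2)) IX (A := K.complement) (B := (𝕊 2) × 𝔼 2) (P := X)
      (gluckRel ν) :=
  Iff.rfl

/-- A Gluck twist is nonempty: it contains the image of `𝕊 2 × ℝ²`. [folklore] -/
theorem IsGluckTwist.nonempty (h : IsGluckTwist IX X K) : Nonempty X := by
  obtain ⟨ν, jA, jB, -⟩ := h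
  exact ⟨jB (⟨EuclideanSpace.single 0 1, by simp⟩, 0)⟩

end GluckTwist

variable [SphereEmbedding.SmoothnessFacts] in
/-- The **unknotted 2-sphere** in `S⁴`: the standard equatorial inclusion `𝕊 2 ↪ 𝕊 4`,
`(x₀, x₁, x₂) ↦ (x₀, x₁, x₂, 0, 0)`. Relies on: isSmoothEmbedding_sphereInclusion (sorried).
Rolfsen, *Knots and Links* (1976), §3.J; outline review #10. [folklore] -/
def unknotTwo : TwoKnot :=
  SphereEmbedding.standard 2 4 (by norm_num)

variable [SphereEmbedding.SmoothnessFacts] in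
/-- The unknotted 2-sphere is the standard inclusion. [folklore] -/
@[simp]
theorem coe_unknotTwo : ⇑unknotTwo = sphereInclusion 2 4 (by norm_num) := rfl

variable [SphereEmbedding.SmoothnessFacts] in
/-- A 2-knot is **unknotted** if it is isotopic to the unknotted 2-sphere. Rolfsen (1976), §3.J.
[cite: RolfsenKnotsLinks1976, §3.J] -/
def TwoKnot.IsUnknot (K : TwoKnot) : Prop :=
  K.IsIsotopic unknotTwo

variable [SphereEmbedding.SmoothnessFacts] in
/-- The unknotted 2-sphere is unknotted. [folklore] -/
theorem isUnknot_unknotTwo : unknotTwo.IsUnknot :=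
  SphereEmbedding.IsIsotopic.refl _

/-! ## Known theorems (sorried) -/

section Theorems

/-- **Existence of the Gluck twist** (Gluck, Trans. AMS 104 (1962), §§8, 17; Gompf–Stipsicz
§6.2): for every 2-knot `K` there is a closed (compact, Hausdorff, second countable) smooth
4-manifold `Σ_K` which is a Gluck twist of `S⁴` along `K`: choose a tubular neighbourhood `ν`
(`TwoKnot.nonempty_tubularNbhd`) and form the pushout of `𝕊 4 ∖ K(𝕊 2)` and `𝕊 2 × ℝ²` along
`gluckRel ν` (a diffeomorphism between open subsets with closed graph, so the pushout is a
Hausdorff manifold; it is compact as the union of the images of `𝕊 4 ∖ ν(𝕊 2 × B₁)` and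
`𝕊 2 × B̄₁`). [cite: GluckTAMS1962, §§8 and 17] -/
def exists_isGluckTwist : Prop :=
  ∀ (K : TwoKnot),
    ∃ (X : Type) (_ : TopologicalSpace X) (_ : T2Space X) (_ : SecondCountableTopology X)
      (_ : ChartedSpace (𝔼 4) X) (_ : IsManifold (𝓡 4) ∞ X) (_ : CompactSpace X),
      IsGluckTwist (𝓡 4) X K

variable {EX HX HX' : Type*} [NormedAddCommGroup EX] [NormedSpace ℝ EX] [TopologicalSpace HX]
  {IX : ModelWithCorners ℝ EX HX} [TopologicalSpace HX'] {IX' : ModelWithCorners ℝ EX HX'}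
  {X X' : Type*} [TopologicalSpace X] [ChartedSpace HX X] [TopologicalSpace X']
  [ChartedSpace HX' X'] {K K' : TwoKnot}

/-- **The Gluck twist is well defined**: it depends neither on the tubular neighbourhood `ν` nor on
the 2-knot within its (ambient) isotopy class: if `X` is a Gluck twist along `K`, `X'` a Gluck
twist along `K'` and `K`, `K'` are isotopic, then `X ≅ X'` (Gluck, Trans. AMS 104 (1962), §8:
uniqueness of tubular neighbourhoods up to ambient isotopy, and `π₀ Diff(S² × S¹)` modulo
diffeomorphisms extending over `S² × D²` has order two, generated by `τ`, which commutes with the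
reflections of either factor; Gordon, Comment. Math. Helv. 51 (1976), §2; Gompf–Stipsicz §6.2).
[cite: GluckTAMS1962, §8; Gordon1976 §2] -/
def nonempty_diffeomorph_of_isGluckTwist : Prop :=
  ∀ [IsManifold IX ∞ X] [IsManifold IX' ∞ X'] (h : IsGluckTwist IX X K) (h' : IsGluckTwist IX' X' K') (hK : K.IsIsotopic K'),
    Nonempty (X ≃ₘ⟮IX, IX'⟯ X')

/-- **A Gluck twist is simply connected** (Seifert–van Kampen: `π₁(S⁴ ∖ K)` is normally generated
by a meridian, which bounds the disc `{x} × D²` after regluing, exactly as before the twist since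
`τ` preserves meridians `{x} × S¹` setwise) (Gluck, Trans. AMS 104 (1962), §17;
Gompf–Stipsicz, Ex. 6.2.2). [cite: GluckTAMS1962, §17] -/
def simplyConnectedSpace_of_isGluckTwist : Prop :=
  ∀ (h : IsGluckTwist IX X K),
    SimplyConnectedSpace X

/-- **A Gluck twist is compact** (it is the union of the images of the compact sets
`𝕊 4 ∖ ν(𝕊 2 × B₁)` and `𝕊 2 × B̄₁`) (Gluck 1962, §17). [cite: GluckTAMS1962, §17] -/
def IsGluckTwist.compactSpace : Prop :=
  ∀ (h : IsGluckTwist IX X K),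
    CompactSpace X

/-- **A Gluck twist is homeomorphic to `S⁴`**: `Σ_K` is a simply connected closed smooth
4-manifold with the integral homology of `S⁴` (Mayer–Vietoris), i.e. a homotopy 4-sphere
(Gluck, Trans. AMS 104 (1962), §17), hence homeomorphic to `S⁴` by Freedman's classification
(Freedman, J. Diff. Geom. 17 (1982), Thm 1.6). Whether it is always *diffeomorphic* to `S⁴` is
open (Kirby Problem 4.24).
[cite: GluckTAMS1962, §17 (homotopy 4-sphere); FreedmanJDG1982 Thm. 1.6] -/
def nonempty_homeomorph_sphere_of_isGluckTwist : Prop :=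
  ∀ {X : Type*} [TopologicalSpace X] [T2Space X] [SecondCountableTopology X] [ChartedSpace (𝔼 4) X] [IsManifold (𝓡 4) ∞ X] (h : IsGluckTwist (𝓡 4) X K),
    Nonempty (X ≃ₜ (𝕊 4))

variable [SphereEmbedding.SmoothnessFacts] in
/-- **The Gluck twist along the unknotted 2-sphere is `S⁴`**: `𝕊 4` itself is a Gluck twist of
`𝕊 4` along `unknotTwo`, since `τ` extends over the complementary `D³ × S¹ = S⁴ ∖ ν(unknot)`
(rotate the `D³` factor) (Gluck, Trans. AMS 104 (1962), §17; Gompf–Stipsicz, Ex. 6.2.2 (a);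
outline §4, sanity theorem). [cite: GluckTAMS1962, §17] -/
def isGluckTwist_sphere_unknotTwo : Prop :=
  IsGluckTwist (𝓡 4) (𝕊 4) unknotTwo

end Theorems

end Literature.Topology.FourManifolds
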